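import Literature.NumberTheory.Automorphic.CuspidalPeterssonForm
import Literature.NumberTheory.Automorphic.AutomorphicRepLieActionGL
import Literature.NumberTheory.Automorphic.StableUniformModerateGrowth
import Literature.NumberTheory.Automorphic.CuspFormsBoundedHC
import Literature.NumberTheory.Automorphic.AutomorphicRepInfinitesimalCharacter
import Literature.NumberTheory.Automorphic.AutomorphicLieDerivSkewAdjointModerateGrowth
import HarnessLib

/-!
# The Lie module of smooth functions of uniform moderate growth with the twisted invariance of a
# unitary twist

Topic `NumberTheory/Automorphic`; namespace
`Literature.NumberTheory.Automorphic.AutomorphicRepData.UnitaryTwist`.  Definitions with bodies and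
theorems; no named fact, no `sorry`.

The auxiliary module `W'` of Borel's injectivity of cuspidal cohomology
(`ResGLnCuspidalCohomologyReduction.coneClass_ne_zero_of_primitive`,
`ResGLnKugaPairedPrimitive.false_of_horizontal_pairedPrimitive`): for an automorphic representation
datum `π = W / W'` of `GL_n(𝔸_K)` and a unitary twist `T` (`|det|^s`, `CuspidalPeterssonForm`),

* `umgSpace T` — the functions `Φ : GL_n(𝔸_K) → ℂ` which are smooth in the archimedean variable,
  of UNIFORM MODERATE GROWTH, all of whose derivatives `p Φ` (`p ∈ ℝ⟨𝔤⟩`) are continuous, and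
  whose twist `|det|^s Φ` is invariant under `A_G · GL_n(K)` — a complex subspace
  (`HasUniformModerateGrowth.add_gl/smul_gl/zero_gl`);
* `lieDeriv_mem_umgSpace` — it is stable under the Lie derivatives (`HasUniformModerateGrowth.lieDeriv_gl'`,
  `applyFree_mul_ι`; the twisted invariance of `X Φ` by `X(|det|^s Φ) = |det|^s (X Φ + s λ(X) Φ)`,
  `lieDeriv_mulChar_of_exp`), whence the Lie representation `umgLieRep T : 𝔤 →ₗ⁅ℝ⁆ End (umgSpace T)`
  (as `AutomorphicRepData.lieRepW`);
* `inclW T : W →ₗ[ℂ] umgSpace T` — the forms of `π` belong to it (stable spaces of automorphic forms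
  have uniform moderate growth, `IsStableSubmodule.hasUniformModerateGrowth_of_mem`; `T.inv`), and
  `inclW_lieDerivW` — the inclusion intertwines the Lie derivatives.

[cite: BorelWallach2000, VII 2.2; XIV 2.3] [cite: MoeglinWaldspurger1995, I.2.3, I.2.17]

## References

* A. Borel, N. Wallach (2000), VII §2, XIV 2.3 (held). [BorelWallach2000]
* C. Moeglin, J.-L. Waldspurger, *Spectral decomposition and Eisenstein series* (1995), I.2.3, I.2.17.
  [MoeglinWaldspurger1995]
-/

noncomputable section

-- Mathlib idiom (Mathlib/Algebra/Lie/OfAssociative.lean), as in `ArchParameterTwistNorm`.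
attribute [local instance 100] LieRing.ofAssociativeRing

open scoped Matrix ComplexConjugate Classical
open Complex NumberField NumberField.mixedEmbedding NumberField.InfinitePlace IsDedekindDomain

namespace Literature.NumberTheory.Automorphic

namespace AutomorphicRepData

open Literature.NumberTheory.GaloisRepresentations (HeckeCharacter ideleGroup)

variable {n : ℕ} {K : Type} [Field K] [NumberField K] {hcpt : isCompact_glFiniteIntegralLevel n K}
  {π : AutomorphicRepData (AutomorphyDatum.gl n K hcpt)}

namespace UnitaryTwist

variable (T : UnitaryTwist π)

/-! ### The space -/

/-- **The auxiliary space `W'_T`**: functions `Φ` on `GL_n(𝔸_K)`, smooth in the archimedean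
variable, of uniform moderate growth, with all derivatives `p Φ` continuous, and whose twist
`|det|^s Φ` is left invariant under `A_G · GL_n(K)`. [cite: BorelWallach2000, VII 2.2; XIV 2.3] -/
def umgSpace : Submodule ℂ ((AdelicGroupData.gl n K).Adelic → ℂ) where
  carrier := {Φ | IsArchSmooth (AutomorphyDatum.gl n K hcpt).ofArch Φ ∧
    HasUniformModerateGrowth (AutomorphyDatum.gl n K hcpt) Φ ∧
    (∀ p : FreeAlgebra ℝ (AutomorphyDatum.gl n K hcpt).arch.lie,
      Continuous (applyFree (AutomorphyDatum.gl n K hcpt).ofArch p Φ)) ∧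
    ∀ γ ∈ (AdelicGroupData.gl n K).quotientSubgroup, ∀ g,
      mulChar (detTwist n T.χ) Φ (γ * g) = mulChar (detTwist n T.χ) Φ g}
  zero_mem' := by
    refine ⟨(archSmooth (AutomorphyDatum.gl n K hcpt).ofArch).zero_mem, HasUniformModerateGrowth.zero_gl, fun p => ?_,
      fun γ _ g => by rw [map_zero, Pi.zero_apply, Pi.zero_apply]⟩
    have h : applyFree (AutomorphyDatum.gl n K hcpt).ofArch p (0 : (AdelicGroupData.gl n K).Adelic → ℂ) = 0 := by
      have := applyFree_smul_right (ι := (AutomorphyDatum.gl n K hcpt).ofArch) p (0 : ℂ)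
        (0 : (AdelicGroupData.gl n K).Adelic → ℂ)
      rwa [zero_smul, zero_smul] at this
    rw [h]
    exact continuous_const
  add_mem' := by
    rintro Φ Ψ ⟨hΦs, hΦu, hΦc, hΦi⟩ ⟨hΨs, hΨu, hΨc, hΨi⟩
    refine ⟨(archSmooth (AutomorphyDatum.gl n K hcpt).ofArch).add_mem hΦs hΨs,
      HasUniformModerateGrowth.add_gl hΦs hΨs hΦu hΨu, fun p => ?_, fun γ hγ g => ?_⟩
    · have hadd : applyFree (AutomorphyDatum.gl n K hcpt).ofArch p (Φ + Ψ) =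
          applyFree (AutomorphyDatum.gl n K hcpt).ofArch p Φ + applyFree (AutomorphyDatum.gl n K hcpt).ofArch p Ψ :=
        applyFree_add_right_of_top _ (archGroupGL_lie n K) (archGroupGL_carrier n K) p hΦs hΨs
      rw [hadd]
      exact (hΦc p).add (hΨc p)
    · rw [map_add, Pi.add_apply, Pi.add_apply, hΦi γ hγ g, hΨi γ hγ g]
  smul_mem' := by
    rintro c Φ ⟨hΦs, hΦu, hΦc, hΦi⟩
    refine ⟨(archSmooth (AutomorphyDatum.gl n K hcpt).ofArch).smul_mem c hΦs, HasUniformModerateGrowth.smul_gl c hΦu,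
      fun p => ?_, fun γ hγ g => ?_⟩
    · rw [applyFree_smul_right]
      exact (hΦc p).const_smul c
    · rw [map_smul, Pi.smul_apply, Pi.smul_apply, hΦi γ hγ g]

variable {T}

/-- Membership, unfolded. [folklore] -/
theorem mem_umgSpace_iff (Φ : (AdelicGroupData.gl n K).Adelic → ℂ) :
    Φ ∈ T.umgSpace ↔ IsArchSmooth (AutomorphyDatum.gl n K hcpt).ofArch Φ ∧
      HasUniformModerateGrowth (AutomorphyDatum.gl n K hcpt) Φ ∧
      (∀ p : FreeAlgebra ℝ (AutomorphyDatum.gl n K hcpt).arch.lie,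
        Continuous (applyFree (AutomorphyDatum.gl n K hcpt).ofArch p Φ)) ∧
      ∀ γ ∈ (AdelicGroupData.gl n K).quotientSubgroup, ∀ g,
        mulChar (detTwist n T.χ) Φ (γ * g) = mulChar (detTwist n T.χ) Φ g :=
  Iff.rfl

/-- Elements are smooth in the archimedean variable. [folklore] -/
theorem isArchSmooth_of_mem_umgSpace {Φ : (AdelicGroupData.gl n K).Adelic → ℂ} (h : Φ ∈ T.umgSpace) :
    IsArchSmooth (AutomorphyDatum.gl n K hcpt).ofArch Φ := h.1

/-- Elements have uniform moderate growth. [cite: MoeglinWaldspurger1995, I.2.3] -/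
theorem hasUniformModerateGrowth_of_mem_umgSpace {Φ : (AdelicGroupData.gl n K).Adelic → ℂ} (h : Φ ∈ T.umgSpace) :
    HasUniformModerateGrowth (AutomorphyDatum.gl n K hcpt) Φ := h.2.1

/-- Elements are continuous (the derivative of order `0`). [folklore] -/
theorem continuous_of_mem_umgSpace {Φ : (AdelicGroupData.gl n K).Adelic → ℂ} (h : Φ ∈ T.umgSpace) : Continuous Φ := by
  have h1 := h.2.2.1 1
  rwa [Literature.NumberTheory.Automorphic.applyFree_one] at h1

/-- The twist of an element is invariant under `A_G · GL_n(K)`. [folklore] -/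
theorem twist_inv_of_mem_umgSpace {Φ : (AdelicGroupData.gl n K).Adelic → ℂ} (h : Φ ∈ T.umgSpace) :
    ∀ γ ∈ (AdelicGroupData.gl n K).quotientSubgroup, ∀ g,
      mulChar (detTwist n T.χ) Φ (γ * g) = mulChar (detTwist n T.χ) Φ g := h.2.2.2

/-! ### Stability under the Lie derivatives -/

/-- **`X(|det|^s Φ) = |det|^s (X Φ) + s λ(X) |det|^s Φ`** for a smooth `Φ` (the differential of
`|det|^s` along `𝔤` is `s λ`, `λ(X) = Tr_{K_∞/ℝ} tr X`). [cite: BorelJacquet1979, 5.7] -/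
theorem lieDeriv_mulChar_detTwist {Φ : (AdelicGroupData.gl n K).Adelic → ℂ}
    (hΦ : IsArchSmooth (AutomorphyDatum.gl n K hcpt).ofArch Φ) (X : (AutomorphyDatum.gl n K hcpt).arch.lie) :
    ∃ c : ℂ, lieDeriv (AutomorphyDatum.gl n K hcpt).ofArch X (mulChar (detTwist n T.χ) Φ) =
      mulChar (detTwist n T.χ) (lieDeriv (AutomorphyDatum.gl n K hcpt).ofArch X Φ) + c • mulChar (detTwist n T.χ) Φ := by
  obtain ⟨lam, -, hlam⟩ := exists_normExponent (n := n) (K := K) hcpt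
  haveI : FiniteDimensional ℝ (mixedSpace K) := inferInstance
  refine ⟨T.s * (lam X : ℂ), ?_⟩
  rw [lieDeriv_mulChar_of_exp _ (detTwist_ofArch_expMem_eq_exp_smul T.hχ hlam) X hΦ, map_add, map_smul]
  rfl

/-- **`W'_T` is stable under the Lie derivatives.** [cite: BorelWallach2000, XIV 2.3] -/
theorem lieDeriv_mem_umgSpace (X : (AutomorphyDatum.gl n K hcpt).arch.lie) {Φ : (AdelicGroupData.gl n K).Adelic → ℂ}
    (h : Φ ∈ T.umgSpace) : lieDeriv (AutomorphyDatum.gl n K hcpt).ofArch X Φ ∈ T.umgSpace := by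
  obtain ⟨hs, hu, hc, hi⟩ := h
  refine ⟨hs.lieDeriv_gl X, hu.lieDeriv_gl' X, fun p => ?_, fun γ hγ g => ?_⟩
  · rw [← applyFree_mul_ι]
    exact hc _
  · obtain ⟨c, hcX⟩ := T.lieDeriv_mulChar_detTwist hs X
    have e : mulChar (detTwist n T.χ) (lieDeriv (AutomorphyDatum.gl n K hcpt).ofArch X Φ) =
        lieDeriv (AutomorphyDatum.gl n K hcpt).ofArch X (mulChar (detTwist n T.χ) Φ) - c • mulChar (detTwist n T.χ) Φ :=
      eq_sub_of_add_eq hcX.symm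
    rw [e, Pi.sub_apply, Pi.sub_apply, Pi.smul_apply, Pi.smul_apply, hi γ hγ g,
      lieDeriv_apply_mul_of_forall_apply_mul (AutomorphyDatum.gl n K hcpt) hi X γ hγ g]

variable (T)

/-- The Lie derivative on `W'_T`. [folklore] -/
def lieDerivU (X : (AutomorphyDatum.gl n K hcpt).arch.lie) (Φ : T.umgSpace) : T.umgSpace :=
  ⟨lieDeriv (AutomorphyDatum.gl n K hcpt).ofArch X Φ, lieDeriv_mem_umgSpace X Φ.2⟩

/-- Unfolding. [folklore] -/
@[simp] theorem coe_lieDerivU (X : (AutomorphyDatum.gl n K hcpt).arch.lie) (Φ : T.umgSpace) :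
    ((T.lieDerivU X Φ : T.umgSpace) : (AdelicGroupData.gl n K).Adelic → ℂ) =
      lieDeriv (AutomorphyDatum.gl n K hcpt).ofArch X Φ := rfl

/-- **The Lie representation of `𝔤 = 𝔤𝔩ₙ(K_∞)` on `W'_T` by Lie derivatives** (as
`AutomorphicRepData.lieRepW`). [cite: BorelJacquet1979, 4.6] -/
def umgLieRep : (AutomorphyDatum.gl n K hcpt).arch.lie →ₗ⁅ℝ⁆ Module.End ℂ T.umgSpace where
  toFun X :=
    { toFun := fun Φ => T.lieDerivU X Φ
      map_add' := fun Φ Ψ => Subtype.ext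
        (IsArchSmooth.lieDeriv_add _ X (isArchSmooth_of_mem_umgSpace Φ.2) (isArchSmooth_of_mem_umgSpace Ψ.2))
      map_smul' := fun c Φ => Subtype.ext
        (lieDeriv_smul X c (Φ : (AdelicGroupData.gl n K).Adelic → ℂ)) }
  map_add' X Y := LinearMap.ext fun Φ =>
    Subtype.ext (IsArchSmooth.lieDeriv_add_left _ (isArchSmooth_of_mem_umgSpace Φ.2) X Y)
  map_smul' a X := LinearMap.ext fun Φ => Subtype.ext (by
    change lieDeriv (AutomorphyDatum.gl n K hcpt).ofArch (a • X) Φ =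
      (a : ℂ) • lieDeriv (AutomorphyDatum.gl n K hcpt).ofArch X Φ
    rw [IsArchSmooth.lieDeriv_smul_left _ (isArchSmooth_of_mem_umgSpace Φ.2), real_smul_fun_eq_coe_smul])
  map_lie' {X Y} := LinearMap.ext fun Φ => Subtype.ext (by
    change lieDeriv (AutomorphyDatum.gl n K hcpt).ofArch ⁅X, Y⁆ Φ =
      lieDeriv (AutomorphyDatum.gl n K hcpt).ofArch X (lieDeriv (AutomorphyDatum.gl n K hcpt).ofArch Y Φ) -
        lieDeriv (AutomorphyDatum.gl n K hcpt).ofArch Y (lieDeriv (AutomorphyDatum.gl n K hcpt).ofArch X Φ)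
    exact lieDeriv_bracket_gl (isArchSmooth_of_mem_umgSpace Φ.2) X Y)

/-- Unfolding. [folklore] -/
theorem umgLieRep_apply (X : (AutomorphyDatum.gl n K hcpt).arch.lie) (Φ : T.umgSpace) :
    T.umgLieRep X Φ = T.lieDerivU X Φ := rfl

/-! ### The forms of `π` -/

/-- **The forms of `π` lie in `W'_T`** (smooth; uniform moderate growth of the elements of a stable
space of automorphic forms; the derivatives are again forms, hence continuous; `T.inv`).
[cite: MoeglinWaldspurger1995, I.2.17] -/
theorem mem_umgSpace_of_mem_W {φ : (AdelicGroupData.gl n K).Adelic → ℂ} (hφ : φ ∈ π.W) : φ ∈ T.umgSpace :=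
  ⟨π.isArchSmooth_of_mem_W hφ, π.stable.hasUniformModerateGrowth_of_mem hφ,
    fun p => continuous_of_mem_automorphicForms_gl (π.stable.le_automorphicForms (π.applyFree_mem_W p hφ)),
    T.inv φ hφ⟩

/-- **The inclusion `W ↪ W'_T`.** [folklore] -/
def inclW : π.W →ₗ[ℂ] T.umgSpace where
  toFun φ := ⟨φ, T.mem_umgSpace_of_mem_W φ.2⟩
  map_add' _ _ := rfl
  map_smul' _ _ := rfl

/-- Unfolding. [folklore] -/
@[simp] theorem coe_inclW (φ : π.W) : ((T.inclW φ : T.umgSpace) : (AdelicGroupData.gl n K).Adelic → ℂ) = φ := rfl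

/-- **The inclusion intertwines the Lie derivatives.** [folklore] -/
theorem inclW_lieDerivW (X : (AutomorphyDatum.gl n K hcpt).arch.lie) (φ : π.W) :
    T.inclW (π.lieDerivW X φ) = T.umgLieRep X (T.inclW φ) :=
  Subtype.ext rfl

end UnitaryTwist

end AutomorphicRepData

end Literature.NumberTheory.Automorphic

end
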